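import Summits.BirchSwinnertonDyer.BirchSwinnertonDyer.Theorems.SylvesterTwoHeegnerIndexThmCOfCMPointLawsTraceForm
import Mathlib.FieldTheory.KummerExtension
import HarnessLib

/-!
# Route `SylvesterTwoHeegnerIndex` (rung K7t), THEOREM C (item 19802): the FIELD / ENDOMORPHISM layer
# of the CM-point laws made KERNEL — `[ζ]` exists, the Kummer field `L_{(p)} = K(∛p)`, `∛2 ∉ L_{(p)}`

HONEST FRAMING (cell b2b-bsdres, seat x1b GEN 52 = O12 class lead; file `--supports
stmt-BirchSwinnertonDyer-19802 --as helper`; THEOREM C stays OPEN). The (C-d) assembly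
`hsyPointTwoDivisibleSevenModNine_of_cmPointLaws(_trace)` (x1b GEN 51) asks, for every `p ≡ 7 (9)`, a datum
(TRACE-)LAWS_p whose FIELD-THEORETIC and ENDOMORPHISM components were HYPOTHESES: `L ⊇ K` of
characteristic `0`, Galois with `Gal(L/K) = {1, σ, σ²}`, `c³ = p`, `σ c = ωc`, an ADDITIVE `θ = [ω]` on
`E₁(L)`, an additive `φ = (x, y) ↦ (c²x, c³y)` (`exists_twistMap`), and `E₁(L)[2] = 0` (⟸ `∛2 ∉ L`, GEN 51
§4). This file DISCHARGES them all, def-free, and restates the assembly over the remaining ARITHMETIC CORE: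
* §1 `exists_rootMulEquiv` — on any Mordell equation `y² = x³ + a₆`, for `ζ³ = 1`, `[ζ] : (x, y) ↦ (ζx, y)`
  EXISTS as `W(L) ≃+ W(L)` (tree `VariableChange.pointEquiv` of the automorphism `(ζ, 0, 0, 0)` of `W`);
* §2 for ANY splitting field `L` of `X³ − a` over `K ∋ ω` (char `0`, `a` not a cube): `IsGalois K L` (Mathlib),
  **`Gal(L/K) = {1, σ, σ²}`, `σ c = ω·c`** for any cube root `c` of `a` (Mathlib's Kummer theory
  `autEquivZmod`), Galois descent of `σ`-fixed elements, **`∛2 ∉ L`** if no `2a^j` is a cube in `K`;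
* §3 in a QUADRATIC number field a prime `p` and `2p^j` (`p` odd) are not cubes (norm to `ℚ`, `v_ℓ`);
* §4 **`exists_kummerCubicField`** — THE PACKAGE for `K ∋ ω` quadratic, `p` an odd prime: literally the
  binders `L, CharZero, IsGalois, σ, hgen, c, hc, hσc` of TRACE-LAWS_p and `∀ z, z³ ≠ 2`;
* §5 **`hsyPointTwoDivisibleSevenModNine_of_cmPointCore`** — the ROUTE DECL from the display fact and the
  CM-POINT CORE alone: `K`-data (`rank_ℤ B(K) = 2`, generator `P₀`, model `C`) and, for every Kummer datum
  handed over by the kernel, CM points `R′, t, T, Y` with Hu–Shu–Yin's trace law (Cor 2.5), `3T = 0`,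
  `Y_L = φ(2R′ − T)` and the display. What stays non-kernel: Shimura reciprocity (C-a)–(C-b), HSY Thm 2.3 (1)
  / Cor 2.5 for the actual CM points, `R = 2R′`, the display for the explicit `Y` (no CM-point carrier).
NO definition, NO named fact, NO sorry; axioms standard; closes no item; nothing booked; no label moves.
References: [HuShuYin2019] p. 4 (`[ω](x,y) = (ωx,y)`), p. 7 (Thm 2.4 (2): `L_{(p)} = K(∛p)`,
`(∛p)^{σ_{ω₃}−1} = ω`; Cor 2.5), p. 8; [SilvermanAEC2009] III.1 Table 3.1, III.10; MEMO-bsd-cm-two v2.9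
§15.5 (C-d), §40.1; Mathlib `FieldTheory.KummerExtension`.
-/


set_option autoImplicit false
-- the Summit-side namespace `Summit.BirchSwinnertonDyer.BirchSwinnertonDyer.…` (summit = problem) is mandated by D-0017
set_option linter.dupNamespace false

noncomputable section

open scoped Classical

open Polynomial
open WeierstrassCurve WeierstrassCurve.Affine WeierstrassCurve.Affine.Point

namespace Summit.BirchSwinnertonDyer.BirchSwinnertonDyer.Theorems.SylvesterTwoThmCTwist

open SylvesterTwoCMNormForm SylvesterTwoThmCTorsion

/-! ## §0 Valuation helpers over `ℚ` -/

/-- `q³ ≠ m²` in `ℚ` as soon as some prime `ℓ` divides `m` exactly once: `3·v_ℓ(q) = 2·v_ℓ(m) = 2` is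
impossible (`m = 0` is excluded by `v_ℓ(0) = 0`). [folklore] -/
theorem pow_three_ne_sq_of_padicValRat_eq_one (ℓ : ℕ) [Fact ℓ.Prime] {q m : ℚ}
    (h1 : padicValRat ℓ m = 1) : q ^ 3 ≠ m ^ 2 := by
  intro h
  have hv := congrArg (padicValRat ℓ) h
  rw [padicValRat.pow, padicValRat.pow, h1, mul_one] at hv
  omega

/-- `v₂(2·p^j) = 1` for an odd prime `p`. [folklore] -/
theorem padicValRat_two_mul_pow {p : ℕ} (hp : p.Prime) (hp2 : p ≠ 2) (j : ℕ) :
    padicValRat 2 (2 * (p : ℚ) ^ j) = 1 := by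
  have hp0 : (p : ℚ) ≠ 0 := by exact_mod_cast hp.ne_zero
  have h22 : padicValRat 2 (2 : ℚ) = 1 := by simpa using padicValRat.self (p := 2) one_lt_two
  have h : padicValNat 2 p = 0 := padicValNat.eq_zero_of_not_dvd fun hd =>
    hp2 ((Nat.prime_dvd_prime_iff_eq Nat.prime_two hp).mp hd).symm
  rw [padicValRat.mul two_ne_zero (pow_ne_zero j hp0), padicValRat.pow, h22, padicValRat.of_nat, h]
  simp

/-! ## §1 `[ζ] : (x, y) ↦ (ζx, y)` EXISTS as an additive automorphism of `y² = x³ + a₆` -/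

section RootMul

variable {L : Type*} [Field L] {W : WeierstrassCurve L} {ζ : L} (hζ : ζ ^ 3 = 1)
  (h1 : W.a₁ = 0) (h2 : W.a₂ = 0) (h3 : W.a₃ = 0) (h4 : W.a₄ = 0)

include hζ in
/-- For the unit `u = ζ` (`ζ³ = 1`): `u⁻¹ = ζ²`. [folklore] -/
theorem rootMul_unit_inv : ((Units.mk0 ζ (ne_zero_of_pow_three_eq_one hζ))⁻¹ : Lˣ).val = ζ ^ 2 := by
  rw [Units.val_inv_eq_inv_val, Units.val_mk0]
  exact inv_eq_of_mul_eq_one_right (by rw [← pow_succ']; exact hζ)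

include hζ in
/-- Under `(u, r, s, t) = (ζ, 0, 0, 0)`: `x′ = u⁻²x = ζ⁴x = ζx`. [cite: SilvermanAEC2009, III.1 Table 3.1] -/
theorem rootMulChange_toX (x : L) :
    (⟨Units.mk0 ζ (ne_zero_of_pow_three_eq_one hζ), 0, 0, 0⟩ : VariableChange L).toX x = ζ * x := by
  rw [VariableChange.toX, rootMul_unit_inv hζ]
  linear_combination ζ * x * hζ

include hζ in
/-- Under `(u, r, s, t) = (ζ, 0, 0, 0)`: `y′ = u⁻³y = ζ⁶y = y`. [cite: SilvermanAEC2009, III.1 Table 3.1] -/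
theorem rootMulChange_toY (x y : L) :
    (⟨Units.mk0 ζ (ne_zero_of_pow_three_eq_one hζ), 0, 0, 0⟩ : VariableChange L).toY x y = y := by
  rw [VariableChange.toY, rootMul_unit_inv hζ]
  linear_combination (ζ ^ 3 + 1) * y * hζ

include hζ h1 h2 h3 h4 in
/-- **The admissible change `(u, r, s, t) = (ζ, 0, 0, 0)` is an AUTOMORPHISM of `y² = x³ + a₆`**
(`aᵢ′ = u^{−i}aᵢ`: `a₆′ = ζ¹²a₆ = a₆`, the other `aᵢ` vanish). [cite: SilvermanAEC2009, III.1 Table 3.1] -/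
theorem rootMulChange_smul :
    (⟨Units.mk0 ζ (ne_zero_of_pow_three_eq_one hζ), 0, 0, 0⟩ : VariableChange L) • W = W := by
  have hu := rootMul_unit_inv hζ
  ext
  · rw [variableChange_a₁, h1]
    simp
  · rw [variableChange_a₂, h1, h2]
    simp
  · rw [variableChange_a₃, h1, h3]
    simp
  · rw [variableChange_a₄, h1, h2, h3, h4]
    simp
  · rw [variableChange_a₆, h1, h2, h3, h4, hu]
    linear_combination (ζ ^ 9 + ζ ^ 6 + ζ ^ 3 + 1) * W.a₆ * hζ

include h1 h2 h3 h4 in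
/-- **`[ζ]` EXISTS as an additive automorphism `W(L) ≃+ W(L)` acting by `(x, y) ↦ (ζx, y)`** for a Mordell
equation `W : y² = x³ + a₆` and `ζ³ = 1`: the tree's `VariableChange.pointEquiv` of `(ζ, 0, 0, 0)` followed
by the transport `Affine.Point.congrEquiv` along `rootMulChange_smul`. For `ζ = ω`, `a₆ = −432n²` this is
the complex multiplication `[ω](x, y) = (ωx, y)` of `E_n` ([HuShuYin2019] p. 4) — the map `θ` of the
(C-d) assembly, whose additivity was a HYPOTHESIS there. [cite: HuShuYin2019, p. 4] -/
theorem exists_rootMulEquiv : ∃ θ : W.toAffine.Point ≃+ W.toAffine.Point,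
    ∀ (x y : L) (h : W.toAffine.Nonsingular x y),
      θ (.some x y h) = .some (ζ * x) y (nonsingular_rootMul h1 h2 h3 h4 hζ h) := by
  refine ⟨(VariableChange.pointEquiv W ⟨Units.mk0 ζ (ne_zero_of_pow_three_eq_one hζ), 0, 0, 0⟩).trans
    (Affine.Point.congrEquiv (rootMulChange_smul hζ h1 h2 h3 h4)), fun x y h => ?_⟩
  simp only [AddEquiv.trans_apply, VariableChange.pointEquiv_some, Affine.Point.congrEquiv_some,
    Affine.Point.some.injEq]
  exact ⟨rootMulChange_toX hζ x, rootMulChange_toY hζ x y⟩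

end RootMul

/-! ## §2 A splitting field `L` of `X³ − a` over `K ∋ ω`: `Gal(L/K) = {1, σ, σ²}`, `σc = ωc`, `∛2 ∉ L` -/

/-- **Galois descent of an element fixed by a generator**: if `Gal(L/K) = {1, σ, σ²}` (finite Galois) and
`σ β = β` then `β ∈ K`. [folklore] -/
theorem exists_algebraMap_eq_of_fixed {K L : Type*} [Field K] [Field L] [Algebra K L] [IsGalois K L]
    [FiniteDimensional K L] {σ : L ≃ₐ[K] L} (hgen : ∀ τ : L ≃ₐ[K] L, τ = 1 ∨ τ = σ ∨ τ = σ * σ)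
    {β : L} (hβ : σ β = β) : ∃ b : K, algebraMap K L b = β := by
  have hfix : ∀ τ : L ≃ₐ[K] L, τ β = β := by
    intro τ
    rcases hgen τ with rfl | rfl | rfl
    · rfl
    · exact hβ
    · rw [AlgEquiv.mul_apply, hβ, hβ]
  exact (IsGalois.mem_range_algebraMap_iff_fixed β).mpr hfix

section Kummer

variable {K : Type*} [Field K] [CharZero K] {ω : K} (hω : ω ^ 2 + ω + 1 = 0)

include hω in
/-- `ω` with `ω² + ω + 1 = 0` lies among the PRIMITIVE cube roots of unity of `K` (characteristic `0`): it
is a root of the third cyclotomic polynomial `X² + X + 1`. [folklore] -/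
theorem omega_mem_primitiveRoots_three : ω ∈ primitiveRoots 3 K := by
  rw [mem_primitiveRoots three_pos, ← Polynomial.isRoot_cyclotomic_iff_charZero three_pos,
    Polynomial.cyclotomic_three, Polynomial.IsRoot.def, eval_add, eval_add, eval_pow, eval_X, eval_one]
  exact hω

variable {a : K} (ha : ∀ b : K, b ^ 3 ≠ a)

omit [CharZero K] in
include ha in
/-- `X³ − a` is irreducible over `K` when `a` is not a cube in `K` (`3` is prime; Mathlib
`X_pow_sub_C_irreducible_of_prime`). [folklore] -/
theorem irreducible_X_pow_three_sub_C : Irreducible (X ^ 3 - C a) :=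
  X_pow_sub_C_irreducible_of_prime Nat.prime_three ha

variable (L : Type*) [Field L] [Algebra K L] [IsSplittingField K L (X ^ 3 - C a)]

include hω ha in
/-- **The Galois group is `{1, σ, σ²}` with `σ c = ω·c`** for any cube root `c ∈ L` of `a`: Kummer theory
(Mathlib `autEquivZmod : Gal(L/K) ≃* ℤ/3`, the class of `1` acting on cube roots of `a` by `ω`). For
`a = p`, `K = ℚ(ω)`: `Gal(L_{(p)}/K) = ⟨σ_{ω₃}⟩` with `(∛p)^{σ_{ω₃}−1} = ω` ([HuShuYin2019] Thm 2.4 (2),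
p. 7, `p ≡ 7 (9)`) — the hypotheses `hgen`, `hσc` of the (C-d) assembly.
[cite: HuShuYin2019, p. 7 (Thm. 2.4 (2))] -/
theorem exists_generator_of_isSplittingField_cubic {c : L} (hc : c ^ 3 = algebraMap K L a) :
    ∃ σ : L ≃ₐ[K] L, (∀ τ : L ≃ₐ[K] L, τ = 1 ∨ τ = σ ∨ τ = σ * σ) ∧ σ c = algebraMap K L ω * c := by
  have H := irreducible_X_pow_three_sub_C ha
  have hζ : IsPrimitiveRoot ω 3 := (mem_primitiveRoots three_pos).mp (omega_mem_primitiveRoots_three hω)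
  refine ⟨(autEquivZmod H L hζ).symm (Multiplicative.ofAdd 1), fun τ => ?_, ?_⟩
  · have hτ : τ = (autEquivZmod H L hζ).symm (Multiplicative.ofAdd ((autEquivZmod H L hζ τ).toAdd)) := by
      rw [ofAdd_toAdd, MulEquiv.symm_apply_apply]
    have h012 : ∀ m : ZMod 3, m = 0 ∨ m = 1 ∨ m = 2 := by decide
    rcases h012 ((autEquivZmod H L hζ τ).toAdd) with h | h | h
    · left
      rw [hτ, h, ofAdd_zero, map_one]
    · right; left
      rw [hτ, h]
    · right; right
      rw [hτ, h, show (2 : ZMod 3) = 1 + 1 from rfl, ofAdd_add, map_mul]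
  · have h := autEquivZmod_symm_apply_natCast H L hc hζ 1
    rw [Nat.cast_one, pow_one, Algebra.smul_def] at h
    exact h

include hω ha in
/-- **No cube root of `2` in the Kummer field.** If `2·a^j` is not a cube in `K` for `j = 0, 1, 2`, then
`z³ ≠ 2` for every `z ∈ L`: else `σ z = ω^i z` (`(σz/z)³ = 1`), so `β := z·c^{3−i}` is `σ`-fixed
(`σ c = ωc`), hence in `K` by Galois descent, with `β³ = 2·a^{3−i}`. For `K = ℚ(ω)`, `a = p` an odd prime
this is `∛2 ∉ L_{(p)} = K(∛p)` — whence `E₁(L_{(p)})[2] = 0`, the hypothesis `h2` of the (C-d) assembly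
(`cubeSumCurve_one_eq_zero_of_two_nsmul_eq_zero`). [cite: HuShuYin2019, p. 8] -/
theorem forall_pow_three_ne_two (h2 : ∀ (b : K) (j : ℕ), b ^ 3 ≠ 2 * a ^ j) : ∀ z : L, z ^ 3 ≠ 2 := by
  -- `L/K` is Galois: a splitting field of the separable `X³ − a`, `ω ∈ K` (Mathlib's Kummer theory)
  haveI := isGalois_of_isSplittingField_X_pow_sub_C ⟨ω, omega_mem_primitiveRoots_three hω⟩
    (irreducible_X_pow_three_sub_C ha) L
  haveI := Polynomial.IsSplittingField.finiteDimensional L (X ^ 3 - C a)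
  haveI : CharZero L := charZero_of_injective_algebraMap (algebraMap K L).injective
  intro z hz
  have hc := rootOfSplitsXPowSubC_pow (n := 3) a L
  set c : L := rootOfSplitsXPowSubC (NeZero.pos 3) a L with hcdef
  obtain ⟨σ, hgen, hσc⟩ := exists_generator_of_isSplittingField_cubic hω ha L hc
  have hωL := omega_algebraMap (L := L) hω
  have hωL3 := omega_pow_three hωL
  have hz0 : z ≠ 0 := by
    rintro rfl
    norm_num at hz
  have hσz3 : (σ : L →+* L) (z ^ 3) = z ^ 3 := by rw [hz, map_ofNat]
  -- a `σ`-fixed `β` with `β³ = 2·a^j` contradicts `h2`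
  have key : ∀ (β : L) (j : ℕ), σ β = β → β ^ 3 = 2 * (algebraMap K L a) ^ j → False := by
    intro β j hβ hβ3
    obtain ⟨b, hb⟩ := exists_algebraMap_eq_of_fixed hgen hβ
    apply h2 b j
    apply (algebraMap K L).injective
    rw [map_pow, hb, hβ3, map_mul, map_pow, map_ofNat]
  rcases map_eq_or_of_map_cube_eq hωL (σ : L →+* L) hz0 hσz3 with h | h | h
  · -- `σ z = z`: `β = z`, `j = 0`
    exact key z 0 h (by rw [pow_zero, mul_one, hz])
  · -- `σ z = ωz`: `β = z·c²`, `j = 2`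
    have h' : σ z = algebraMap K L ω * z := h
    refine key (z * c ^ 2) 2 ?_ ?_
    · rw [map_mul, map_pow, h', hσc]
      linear_combination z * c ^ 2 * hωL3
    · calc (z * c ^ 2) ^ 3 = z ^ 3 * (c ^ 3) ^ 2 := by ring
        _ = 2 * (algebraMap K L a) ^ 2 := by rw [hz, hc]
  · -- `σ z = ω²z`: `β = z·c`, `j = 1`
    have h' : σ z = (algebraMap K L ω) ^ 2 * z := h
    refine key (z * c) 1 ?_ ?_
    · rw [map_mul, h', hσc]
      linear_combination z * c * hωL3
    · calc (z * c) ^ 3 = z ^ 3 * c ^ 3 := by ring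
        _ = 2 * (algebraMap K L a) ^ 1 := by rw [hz, hc, pow_one]

end Kummer

/-! ## §3 Over a QUADRATIC number field `K`: `p` and `2·p^j` are not cubes (norm to `ℚ`, valuations) -/

section Quadratic

variable {K : Type*} [Field K] [NumberField K] (h2K : Module.finrank ℚ K = 2)

include h2K in
/-- **In a quadratic number field no cube equals a rational `m` with `v_ℓ(m) = 1`** for some prime `ℓ`:
taking norms, `N(b)³ = N(m) = m²`, and `q³ ≠ m²` in `ℚ`. [folklore] -/
theorem pow_three_ne_algebraMap_of_padicValRat_eq_one (ℓ : ℕ) [Fact ℓ.Prime] {m : ℚ}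
    (h1 : padicValRat ℓ m = 1) (b : K) : b ^ 3 ≠ algebraMap ℚ K m := by
  intro h
  have e := congrArg (Algebra.norm ℚ) h
  rw [map_pow, Algebra.norm_algebraMap, h2K] at e
  exact pow_three_ne_sq_of_padicValRat_eq_one ℓ h1 e

include h2K in
/-- **A prime `p` is not a cube in a quadratic number field** (`v_p(p) = 1`); so `X³ − p` is irreducible
over `K = ℚ(ω)` and `[K(∛p) : K] = 3`. [folklore] -/
theorem forall_pow_three_ne_natCast {p : ℕ} (hp : p.Prime) : ∀ b : K, b ^ 3 ≠ (p : K) := by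
  haveI := Fact.mk hp
  intro b
  have h := pow_three_ne_algebraMap_of_padicValRat_eq_one h2K p (padicValRat.self hp.one_lt) b
  rwa [map_natCast] at h

include h2K in
/-- **`2·p^j` is not a cube in a quadratic number field** for an odd prime `p` (`v₂(2p^j) = 1`): the
hypothesis `h2` of `forall_pow_three_ne_two` for `a = p`. [folklore] -/
theorem forall_pow_three_ne_two_mul_pow {p : ℕ} (hp : p.Prime) (hp2 : p ≠ 2) :
    ∀ (b : K) (j : ℕ), b ^ 3 ≠ 2 * (p : K) ^ j := by
  intro b j
  have h := pow_three_ne_algebraMap_of_padicValRat_eq_one h2K 2 (padicValRat_two_mul_pow hp hp2 j) b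
  rwa [map_mul, map_pow, map_natCast, map_ofNat] at h

end Quadratic

/-! ## §4 THE KUMMER FIELD PACKAGE for the (C-d) assembly -/

/-- **THE KUMMER FIELD PACKAGE.** For a quadratic number field `K ∋ ω` (`ω² + ω + 1 = 0`) and an odd
prime `p` there is a field `L ⊇ K` — a splitting field of `X³ − p`, i.e. `L = K(∛p) = L_{(p)}` — of
characteristic `0`, Galois over `K` with `Gal(L/K) = {1, σ, σ²}`, a cube root `c ∈ L` of `p` with
`σ c = ω·c`, and NO cube root of `2`: exactly the binders `L`, `CharZero L`, `IsGalois K L`, `σ`, `hgen`,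
`c`, `hc`, `hσc` of TRACE-LAWS_p, and (via `cubeSumCurve_one_eq_zero_of_two_nsmul_eq_zero`) its
`h2 : E₁(L)[2] = 0`. [cite: HuShuYin2019, p. 7 (Thm. 2.4 (2)), p. 8] -/
theorem exists_kummerCubicField (K : Type) [Field K] [NumberField K] (h2K : Module.finrank ℚ K = 2)
    {ω : K} (hω : ω ^ 2 + ω + 1 = 0) {p : ℕ} (hp : p.Prime) (hp2 : p ≠ 2) :
    ∃ (L : Type) (_ : Field L) (_ : CharZero L) (_ : Algebra K L) (_ : IsGalois K L)
      (σ : L ≃ₐ[K] L) (_ : ∀ τ : L ≃ₐ[K] L, τ = 1 ∨ τ = σ ∨ τ = σ * σ)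
      (c : L) (_ : c ^ 3 = ((p : ℚ) : L)) (_ : σ c = algebraMap K L ω * c),
      ∀ z : L, z ^ 3 ≠ 2 := by
  have ha := forall_pow_three_ne_natCast h2K hp
  haveI := isGalois_of_isSplittingField_X_pow_sub_C ⟨ω, omega_mem_primitiveRoots_three hω⟩
    (irreducible_X_pow_three_sub_C ha) (X ^ 3 - C (p : K)).SplittingField
  have hc := rootOfSplitsXPowSubC_pow (n := 3) (p : K) (X ^ 3 - C (p : K)).SplittingField
  obtain ⟨σ, hgen, hσc⟩ :=
    exists_generator_of_isSplittingField_cubic hω ha (X ^ 3 - C (p : K)).SplittingField hc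
  refine ⟨(X ^ 3 - C (p : K)).SplittingField, inferInstance, inferInstance, inferInstance, inferInstance,
    σ, hgen, _, ?_, hσc, forall_pow_three_ne_two hω ha _ (forall_pow_three_ne_two_mul_pow h2K hp hp2)⟩
  rw [hc, Rat.cast_natCast]
  exact map_natCast (algebraMap K _) p

/-! ## §5 THEOREM C from the CM-POINT CORE: the field / endomorphism layer discharged by the kernel -/

section Core

open Literature.NumberTheory.EllipticCurves Literature.NumberTheory.EllipticCurves.HuShuYin2019

/-- **THEOREM C FROM THE CM-POINT CORE** (route decl). As `hsyPointTwoDivisibleSevenModNine_of_cmPointLaws_trace`,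
but the datum asked for each `p ≡ 7 (9)` is only the ARITHMETIC CORE: a quadratic number field `K ∋ ω` with
`rank_ℤ B(K) = 2` and a generator `P₀` of `B(ℚ)` mod torsion, a model isomorphism `C`, and — for EVERY
Kummer datum `(L, σ, c, [ω], φ)` HANDED OVER BY THE KERNEL (`L ⊇ K` char `0`, Galois, `Gal = {1, σ, σ²}`,
`c³ = p`, `σ c = ωc`, additive `[ω]` on `E₁(L)`, additive scaling `φ : E₁(L) ≃+ E_p(L)`) — CM points
`R′, t, T ∈ E₁(L)`, `Y ∈ B(K)` with the trace law `σ(2R′) = [ω](2R′) + t`, `t ∈ {𝒪, (0, ±12√−3)}`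
([HuShuYin2019] Cor 2.5), `3T = 0`, `Y_L = φ(2R′ − T)`, and the display `(qB·qA)·ĥ(P₀) = ¼·ĥ(Y)`,
`qB·qA ≠ 0`. The Kummer datum comes from `exists_kummerCubicField`, `exists_rootMulEquiv`, `exists_twistMap`,
`E₁(L)[2] = 0` from `cubeSumCurve_one_eq_zero_of_two_nsmul_eq_zero`. The item stays OPEN (core = Shimura
reciprocity (C-a)–(C-b), HSY Thm 2.3 (1) / Cor 2.5, `R = 2R′`, the display for the explicit `Y`).
[cite: HuShuYin2019, p. 7 (Cor. 2.5), pp. 8, 12] -/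
theorem hsyPointTwoDivisibleSevenModNine_of_cmPointCore
    (hH : shaAnPair_mul_height_eq_two_zpow_mul_height)
    (hCore : ∀ (p : ℕ), p.Prime → p % 9 = 7 → (¬ ∃ x : ZMod p, x ^ 3 = 3) →
      ∀ (A B : WeierstrassCurve ℚ) [A.IsElliptic] [A.IsGloballyMinimal] [B.IsElliptic] [B.IsGloballyMinimal],
      (∃ C : VariableChange ℚ, C • B = cubeSumCurve (p : ℚ)) →
      (∃ C : VariableChange ℚ, C • A = cubeSumCurve (3 * (p : ℚ) ^ 2)) →
      ∀ (qB qA : ℚ), shaAn B = (qB : ℂ) → shaAn A = (qA : ℂ) →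
      ∃ (K : Type) (_ : Field K) (_ : NumberField K) (ω : K) (_ : ω ^ 2 + ω + 1 = 0)
        (_ : Module.finrank ℚ K = 2) (_ : (B.baseChange K).mordellWeilRank = 2)
        (P₀ : B.toAffine.Point) (_ : ¬ IsOfFinAddOrder (QuadraticDescent.incl K B P₀))
        (_ : ∀ Q : B.toAffine.Point, ∃ m : ℤ,
          IsOfFinAddOrder (QuadraticDescent.incl K B Q - m • QuadraticDescent.incl K B P₀))
        (C : VariableChange ℚ) (_ : C • B = cubeSumCurve (p : ℚ))
        (hCK : (C • B).baseChange K = (cubeSumCurve (p : ℚ)).baseChange K),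
      ∀ (L : Type) [Field L] [CharZero L] [Algebra K L] [IsGalois K L]
        (σ : L ≃ₐ[K] L) (_ : ∀ τ : L ≃ₐ[K] L, τ = 1 ∨ τ = σ ∨ τ = σ * σ)
        (c : L) (_ : c ^ 3 = ((p : ℚ) : L)) (_ : σ c = algebraMap K L ω * c)
        (θ : ((cubeSumCurve 1).baseChange L).toAffine.Point ≃+ ((cubeSumCurve 1).baseChange L).toAffine.Point)
        (_ : ∀ (x y : L) (h : ((cubeSumCurve 1).baseChange L).toAffine.Nonsingular x y),
          ∃ h', θ (.some x y h) = .some (algebraMap K L ω * x) y h')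
        (φ : ((cubeSumCurve 1).baseChange L).toAffine.Point ≃+
          ((cubeSumCurve (p : ℚ)).baseChange L).toAffine.Point)
        (_ : ∀ (x y : L) (h : ((cubeSumCurve 1).baseChange L).toAffine.Nonsingular x y),
          ∃ h', φ (.some x y h) = .some (c ^ 2 * x) (c ^ 3 * y) h'),
      ∃ (R' t T : ((cubeSumCurve 1).baseChange L).toAffine.Point) (Y : (B.baseChange K).toAffine.Point),
        Affine.Point.map (σ : L →ₐ[K] L) ((2 : ℕ) • R') = θ ((2 : ℕ) • R') + t ∧
        (t = 0 ∨ (∃ h, t = .some 0 (12 * (2 * algebraMap K L ω + 1)) h) ∨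
          (∃ h, t = .some 0 (-(12 * (2 * algebraMap K L ω + 1))) h)) ∧
        (3 : ℕ) • T = 0 ∧
        Affine.Point.map (algebraMap K L).toRatAlgHom
            (Affine.Point.congrEquiv hCK (VariableChange.pointEquivBaseChange B C K Y)) =
          φ ((2 : ℕ) • R' - T) ∧
        ((qB * qA : ℚ) : ℝ) * canonicalHeight (QuadraticDescent.incl K B P₀) =
          (2 : ℝ) ^ (-2 : ℤ) * canonicalHeight Y ∧ qB * qA ≠ 0) :
    Summit.BirchSwinnertonDyer.BirchSwinnertonDyer.Theses.SylvesterTwoHeegnerIndex.HSYPointTwoDivisibleSevenModNine := by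
  refine SylvesterTwoNonneg.hsyPointTwoDivisibleSevenModNine_of_heightDisplay_of_twoIntegral hH ?_
  intro p hp h7 h3 A B _ _ _ _ hB hA qB qA hqB hqA
  obtain ⟨K, _, _, ω, hω, h2K, hrank, P₀, hP, hgenB, C, hC, hCK, hcore⟩ :=
    hCore p hp h7 h3 A B hB hA qB qA hqB hqA
  have hp2 : p ≠ 2 := by rintro rfl; norm_num at h7
  have hp0 : (p : ℚ) ≠ 0 := by exact_mod_cast hp.ne_zero
  -- the Kummer datum, supplied by the kernel (§§1–4 and `exists_twistMap`)
  obtain ⟨L, _, _, _, _, σ, hgen, c, hc, hσc, hcbrt⟩ := exists_kummerCubicField K h2K hω hp hp2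
  have hωL := omega_algebraMap (L := L) hω
  obtain ⟨θ, hθ⟩ := exists_rootMulEquiv (W := (cubeSumCurve 1).baseChange L) (omega_pow_three hωL)
    (cubeSumCurve_baseChange_a₁ 1) (cubeSumCurve_baseChange_a₂ 1) (cubeSumCurve_baseChange_a₃ 1)
    (cubeSumCurve_baseChange_a₄ 1)
  obtain ⟨φ, hφ⟩ := exists_twistMap (W := (cubeSumCurve 1).baseChange L)
    (W' := (cubeSumCurve (p : ℚ)).baseChange L) (cbrt_ne_zero hc hp0)
    (cubeSumCurve_baseChange_a₁ 1) (cubeSumCurve_baseChange_a₂ 1) (cubeSumCurve_baseChange_a₃ 1)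
    (cubeSumCurve_baseChange_a₄ 1) (cubeSumCurve_baseChange_a₁ p) (cubeSumCurve_baseChange_a₂ p)
    (cubeSumCurve_baseChange_a₃ p) (cubeSumCurve_baseChange_a₄ p) (cubeSumCurve_baseChange_a₆_twist hc)
  have hθ' : ∀ (x y : L) (h : ((cubeSumCurve 1).baseChange L).toAffine.Nonsingular x y),
      ∃ h', θ (.some x y h) = .some (algebraMap K L ω * x) y h' := fun x y h => ⟨_, hθ x y h⟩
  have hφ' : ∀ (x y : L) (h : ((cubeSumCurve 1).baseChange L).toAffine.Nonsingular x y),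
      ∃ h', φ (.some x y h) = .some (c ^ 2 * x) (c ^ 3 * y) h' := fun x y h => ⟨_, hφ x y h⟩
  -- the CM-point core for THIS datum
  obtain ⟨R', t, T, Y, hR, ht, hT, hY, hdisp, hq⟩ := hcore L σ hgen c hc hσc θ hθ' φ hφ'
  -- the (C-d) assembly in trace form, then two's `2`-integrality reading of `2`-divisibility
  have h2div := exists_eq_two_smul_add_torsion_of_cmPointLaws_trace hω hc hp0 B C hCK σ hgen hσc
    (_root_.map_zero θ) hθ (fun P Q => _root_.map_add θ P Q) (_root_.map_zero φ) hφ
    (fun P Q => _root_.map_add φ P Q) (cubeSumCurve_one_eq_zero_of_two_nsmul_eq_zero hcbrt) hR ht hT Y hY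
  have hle := SylvesterTwoNonneg.add_two_le_padicValRat_two_of_model_of_twoDivisible hω h2K hp hp2 B C hC
    hrank P₀ hP hgenB Y hq hdisp h2div
  linarith

end Core

end Summit.BirchSwinnertonDyer.BirchSwinnertonDyer.Theorems.SylvesterTwoThmCTwist

end
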